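import Mathlib
import Literature.Computability.Complexity.CliqueTestGraphs
import Summits.PneNP.PneNP.Theorems.CliqueExtLowerBound.Negative.LargeCliquesTwoSat
import Summits.PneNP.PneNP.Theorems.ConvexRankGatesConvexGateBlindCliqueNonnegL1
import Summits.PneNP.PneNP.Theorems.ConvexRankGatesConvexGateBlindCliqueNonnegMinimal
import Summits.PneNP.PneNP.Theorems.ConvexRankGatesConvexGateBlindMonoMoment

/-!
# PneNP / ConvexRankGates — `ConvexGateBlind`: the catch probability of a negative-cover generator is exponentially small

Helpers (`--supports stmt-PneNP-10680`), COLUMN-SPACE line (prover seat 2, session 13), assembling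
`…CliqueNonnegL1.lean` (ℓ₁-domination, entry bound), `…CliqueNonnegMinimal.lean` (minimal reduction) and
`…MonoMoment.lean` (exponential moments of the monochromatic mass).

THEOREM (`card_badColourings_le`, stub `negCover_catch`). Let `4 ≤ k`, `k + 2 ≤ m`, `q = k − 1`, and let `w` be a
`k`-clique-non-negative edge weighting of `K_m` (`w(E(Q)) ≥ 0` on every `k`-set `Q`). Call a colouring
`c : Fin m → Fin q` BAD for `w` if the complete `q`-partite graph `colorVec c` of `c` (a `k`-clique-free graph) has
negative `w`-weight, `∑_{e bichromatic} w(e) < 0` — the event that `w` "catches" the column `colorVec c` in the counting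
bound `card_le_mul_of_negCover` of `…NegCover.lean`. Then

  `#{c BAD for w} ≤ q^m · exp(−1 / (512 · L² · √β))`,   `L = 2k² − 4k + 1`,   `β = C(k,2)·(k−2)/(m−k)`,

i.e. a uniformly random colouring is bad with probability `≤ exp(−Ω(√(m−k) / k^{5.5}))`. PROOF. Replace `w` by a
minimal `v ≤ w` (bad stays bad); normalise `W = ∑ v > 0` (else `v = 0`); all entries are `≤ β·W` in absolute value
(entry bound + tightness), `∑_x deg(x) = 2∑|v| ≤ 2LW`; the hubs `H = {deg ≥ τ}` are `≤ 2LW/τ` many and carry absolute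
mass `≤ W/8` for `τ = 4LW√β`; a bad colouring has monochromatic mass `> W`, hence the hub-corrected centred mass
`T(c) ≥ W/2`; the exponential moment bound with `λ = 1/(32τL)` and Markov give `q^m·exp(−λW/2 + 8λ²τLW) = q^m·exp(−1/(512L²√β))`.
[new]
-/

set_option linter.dupNamespace false

namespace Summit.PneNP.PneNP.Theorems

open Finset Real Literature.Computability.Complexity
open Summit.PneNP.PneNP.Cruxes.ConvexGateBlind.StrictRankConicCover (Edge)

noncomputable section

variable {m : ℕ}

/-! ## From edge functions to symmetric matrices -/

/-- For an edge `e = {a, b}`: `∑_x ∑_y 𝟙[s(x,y) = e]·t = 2t` (the two orderings). [folklore] -/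
theorem sum_sum_ite_mk_eq (e : Edge m) (t : ℝ) :
    ∑ x : Fin m, ∑ y : Fin m, (if s(x, y) = (e : Sym2 (Fin m)) then t else 0) = 2 * t := by
  classical
  obtain ⟨z, hz⟩ := e
  induction z using Sym2.ind with
  | h a b =>
    have hab : a ≠ b := by simpa using hz
    have hpt : ∀ x y : Fin m, (if s(x, y) = s(a, b) then t else 0) =
        (if x = a ∧ y = b then t else 0) + (if x = b ∧ y = a then t else 0) := by
      intro x y
      by_cases h1 : x = a ∧ y = b
      · obtain ⟨rfl, rfl⟩ := h1
        rw [if_pos rfl, if_pos ⟨rfl, rfl⟩, if_neg (fun h => hab h.1), add_zero]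
      · by_cases h2 : x = b ∧ y = a
        · obtain ⟨rfl, rfl⟩ := h2
          rw [if_pos Sym2.eq_swap, if_neg h1, if_pos ⟨rfl, rfl⟩, zero_add]
        · rw [if_neg, if_neg h1, if_neg h2, add_zero]
          rw [Sym2.eq_iff]
          push Not
          exact ⟨fun hx hy => h1 ⟨hx, hy⟩, fun hx hy => h2 ⟨hx, hy⟩⟩
    have hone : ∀ a b : Fin m, ∑ x : Fin m, ∑ y : Fin m, (if x = a ∧ y = b then t else 0) = t := by
      intro a b
      rw [Finset.sum_eq_single a]
      · rw [Finset.sum_eq_single b]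
        · rw [if_pos ⟨rfl, rfl⟩]
        · intro y _ hy; rw [if_neg (fun h => hy h.2)]
        · intro h; exact absurd (Finset.mem_univ _) h
      · intro x _ hx; exact Finset.sum_eq_zero (fun y _ => if_neg (fun h => hx h.1))
      · intro h; exact absurd (Finset.mem_univ _) h
    simp_rw [hpt, Finset.sum_add_distrib]
    rw [hone a b, hone b a]
    ring

/-- **Edge sums as half ordered-pair sums.** If `Φ` vanishes on the diagonal and `Φ x y = φ{x,y}` off it, then
`∑_e φ(e) = (∑_x ∑_y Φ x y) / 2`. [folklore] -/
theorem sum_edge_eq_half_sum_sum (φ : Edge m → ℝ) (Φ : Fin m → Fin m → ℝ) (hdiag : ∀ x, Φ x x = 0)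
    (hoff : ∀ (x y : Fin m) (h : x ≠ y), Φ x y = φ ⟨s(x, y), CliqueExtLowerBound.Negative.mk_mem_edgeSet_top h⟩) :
    ∑ e, φ e = (∑ x, ∑ y, Φ x y) / 2 := by
  classical
  -- `Φ x y = ∑_e 𝟙[e = s(x,y)] φ e`
  have hpt : ∀ x y : Fin m, Φ x y = ∑ e : Edge m, (if s(x, y) = (e : Sym2 (Fin m)) then φ e else 0) := by
    intro x y
    by_cases hxy : x = y
    · subst hxy
      rw [hdiag, Finset.sum_eq_zero]
      intro e _
      rw [if_neg]
      intro h
      have he := e.2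
      rw [← h] at he
      simp at he
    · rw [hoff x y hxy, Finset.sum_eq_single (⟨s(x, y), CliqueExtLowerBound.Negative.mk_mem_edgeSet_top hxy⟩ : Edge m)]
      · rw [if_pos rfl]
      · rintro e - hne
        rw [if_neg]
        intro h
        exact hne (Subtype.ext h.symm)
      · intro h; exact absurd (Finset.mem_univ _) h
  simp_rw [hpt]
  have hin : ∀ x : Fin m, ∑ y, ∑ e : Edge m, (if s(x, y) = (e : Sym2 (Fin m)) then φ e else 0) =
      ∑ e : Edge m, ∑ y, (if s(x, y) = (e : Sym2 (Fin m)) then φ e else 0) := fun x => Finset.sum_comm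
  simp_rw [hin]
  rw [Finset.sum_comm]
  have hfib : ∀ e : Edge m, ∑ x, ∑ y, (if s(x, y) = (e : Sym2 (Fin m)) then φ e else 0) = 2 * φ e :=
    fun e => sum_sum_ite_mk_eq e (φ e)
  simp_rw [hfib]
  rw [← Finset.mul_sum]
  ring

/-- The colouring vector is off exactly on the monochromatic edges. [folklore] -/
theorem colorVec_mk_eq_false_iff {K : ℕ} (c : Fin m → Fin K) {x y : Fin m} (hxy : s(x, y) ∈ (⊤ : SimpleGraph (Fin m)).edgeSet) :
    colorVec c ⟨s(x, y), hxy⟩ = false ↔ c x = c y := by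
  simp [colorVec]

/-! ## The catch bound, matrix form -/

/-- **Catch bound, matrix form.** Let `V` be a symmetric zero-diagonal matrix on `Fin m`, `3 ≤ q`, `0 < W`, `1 ≤ L`,
`0 < β` with `∑_x ∑_y |V x y| ≤ 2LW`, `|V x y| ≤ βW` and `∑_x ∑_y V x y = 2W`. Then the number of colourings
`c : Fin m → Fin q` with monochromatic mass `½∑∑ 𝟙[c a = c b] V a b > W` is at most `q^m · exp(−1/(512 L² √β))`.
(Hubs `H = {deg ≥ τ}`, `τ = 4LW√β`; `…MonoMoment.expMoment_le` with `λ = 1/(32τL)`; Markov at `W/2`.) [new] -/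
theorem card_monoMass_gt_le {q : ℕ} (hq : 3 ≤ q) (V : Fin m → Fin m → ℝ) (hVsym : ∀ x y, V x y = V y x)
    (hV0 : ∀ x, V x x = 0) {W L β : ℝ} (hWpos : 0 < W) (hL1 : 1 ≤ L) (hβ0 : 0 < β)
    (hdegsum : ∑ x, ∑ y, |V x y| ≤ 2 * L * W) (hVabs : ∀ x y, |V x y| ≤ β * W)
    (hmass : ∑ x, ∑ y, V x y = 2 * W) :
    ((((Finset.univ : Finset (Fin m → Fin q)).filter fun c =>
        W < (∑ a, ∑ b, if c a = c b then V a b else 0) / 2).card : ℝ)) ≤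
      (q : ℝ) ^ m * Real.exp (-(1 / (512 * L ^ 2 * Real.sqrt β))) := by
  classical
  have hqpos : 0 < q := by omega
  have hqR3 : (3 : ℝ) ≤ q := by exact_mod_cast hq
  have hqRpos : (0 : ℝ) < q := by linarith
  have hLpos : 0 < L := by linarith
  have hsqβ : 0 < Real.sqrt β := Real.sqrt_pos.2 hβ0
  have hdeg0 : ∀ x, 0 ≤ ∑ y, |V x y| := fun x => Finset.sum_nonneg fun y _ => abs_nonneg _
  -- the scale `τ` and the hubs
  obtain ⟨τ, hτ⟩ : ∃ τ : ℝ, τ = 4 * L * W * Real.sqrt β := ⟨_, rfl⟩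
  have hτpos : 0 < τ := by rw [hτ]; exact mul_pos (mul_pos (mul_pos (by norm_num) hLpos) hWpos) hsqβ
  have hLne : L ≠ 0 := hLpos.ne'
  have hWne : W ≠ 0 := hWpos.ne'
  have hτne : τ ≠ 0 := hτpos.ne'
  have hβne : β ≠ 0 := hβ0.ne'
  have hsqne : Real.sqrt β ≠ 0 := hsqβ.ne'
  obtain ⟨H, hH⟩ : ∃ H : Finset (Fin m), H = (Finset.univ : Finset (Fin m)).filter (fun x => τ ≤ ∑ y, |V x y|) :=
    ⟨_, rfl⟩
  have hmemH : ∀ x, x ∈ H ↔ τ ≤ ∑ y, |V x y| := fun x => by rw [hH, Finset.mem_filter]; simp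
  have hHle : (H.card : ℝ) ≤ 2 * L * W / τ := by
    rw [le_div_iff₀ hτpos]
    calc (H.card : ℝ) * τ = ∑ _x ∈ H, τ := by rw [Finset.sum_const, nsmul_eq_mul]
      _ ≤ ∑ x ∈ H, ∑ y, |V x y| := Finset.sum_le_sum fun x hx => (hmemH x).1 hx
      _ ≤ ∑ x, ∑ y, |V x y| :=
          Finset.sum_le_sum_of_subset_of_nonneg (Finset.subset_univ _) fun x _ _ => hdeg0 x
      _ ≤ 2 * L * W := hdegsum
  -- absolute mass inside the hubs
  obtain ⟨A, hA⟩ : ∃ A : ℝ, A = (∑ a ∈ H, ∑ b ∈ H, |V a b|) / 2 := ⟨_, rfl⟩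
  have hA0 : 0 ≤ A := by rw [hA]; positivity
  have hAle : A ≤ W / 8 := by
    have hβW : 0 ≤ β * W := (mul_pos hβ0 hWpos).le
    have h1 : ∑ a ∈ H, ∑ b ∈ H, |V a b| ≤ (H.card : ℝ) * ((H.card : ℝ) * (β * W)) := by
      calc ∑ a ∈ H, ∑ b ∈ H, |V a b| ≤ ∑ _a ∈ H, ∑ _b ∈ H, β * W :=
            Finset.sum_le_sum fun a _ => Finset.sum_le_sum fun b _ => hVabs a b
        _ = (H.card : ℝ) * ((H.card : ℝ) * (β * W)) := by
            rw [Finset.sum_const, Finset.sum_const, nsmul_eq_mul, nsmul_eq_mul]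
    have h2 : (H.card : ℝ) * ((H.card : ℝ) * (β * W)) ≤ (2 * L * W / τ) * ((2 * L * W / τ) * (β * W)) :=
      mul_le_mul hHle (mul_le_mul_of_nonneg_right hHle hβW) (mul_nonneg (Nat.cast_nonneg _) hβW)
        ((Nat.cast_nonneg _).trans hHle)
    have h3 : (2 * L * W / τ) * ((2 * L * W / τ) * (β * W)) = W / 4 := by
      have hτsq : τ ^ 2 = 16 * L ^ 2 * W ^ 2 * β := by
        rw [hτ, mul_pow, Real.sq_sqrt hβ0.le]; ring
      calc (2 * L * W / τ) * ((2 * L * W / τ) * (β * W)) = (2 * L * W) ^ 2 * (β * W) / τ ^ 2 := by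
            field_simp
        _ = (2 * L * W) ^ 2 * (β * W) / (16 * L ^ 2 * W ^ 2 * β) := by rw [hτsq]
        _ = W / 4 := by field_simp; ring
    rw [hA]
    linarith
  have hMH : ∀ c : Fin m → Fin q, (∑ a ∈ H, ∑ b ∈ H, if c a = c b then V a b else 0) / 2 ≤ A := by
    intro c
    rw [hA]
    refine div_le_div_of_nonneg_right (Finset.sum_le_sum fun a _ => Finset.sum_le_sum fun b _ => ?_) (by norm_num)
    split_ifs
    · exact le_abs_self _
    · exact abs_nonneg _
  have hmassH : -A ≤ (∑ a ∈ H, ∑ b ∈ H, V a b) / 2 := by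
    rw [hA, ← neg_div, ← Finset.sum_neg_distrib]
    refine div_le_div_of_nonneg_right (Finset.sum_le_sum fun a _ => ?_) (by norm_num)
    rw [← Finset.sum_neg_distrib]
    exact Finset.sum_le_sum fun b _ => neg_abs_le _
  -- the centred hub-corrected mass `T`
  obtain ⟨T, hT⟩ : ∃ T : (Fin m → Fin q) → ℝ, ∀ c, T c =
      (∑ a, ∑ b, if c a = c b then V a b else 0) / 2 - (∑ a ∈ H, ∑ b ∈ H, if c a = c b then V a b else 0) / 2 -
        ((∑ a, ∑ b, V a b) / 2 - (∑ a ∈ H, ∑ b ∈ H, V a b) / 2) / q := ⟨fun c => _, fun c => rfl⟩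
  have hsub : ((Finset.univ : Finset (Fin m → Fin q)).filter fun c =>
        W < (∑ a, ∑ b, if c a = c b then V a b else 0) / 2) ⊆
      (Finset.univ : Finset (Fin m → Fin q)).filter (fun c => W / 2 ≤ T c) := by
    intro c hc
    rw [Finset.mem_filter] at hc ⊢
    refine ⟨hc.1, ?_⟩
    have h1 := hc.2
    have h2 := hMH c
    have h3 : ((∑ a, ∑ b, V a b) / 2 - (∑ a ∈ H, ∑ b ∈ H, V a b) / 2) / q ≤ (W + A) / 3 := by
      rw [hmass]
      have hnum : 2 * W / 2 - (∑ a ∈ H, ∑ b ∈ H, V a b) / 2 ≤ W + A := by linarith [hmassH]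
      have hWA : 0 ≤ W + A := by linarith
      calc (2 * W / 2 - (∑ a ∈ H, ∑ b ∈ H, V a b) / 2) / q ≤ (W + A) / q :=
            div_le_div_of_nonneg_right hnum hqRpos.le
        _ ≤ (W + A) / 3 := div_le_div_of_nonneg_left hWA (by norm_num) hqR3
    rw [hT c]
    linarith
  refine le_trans (Nat.cast_le.2 (Finset.card_le_card hsub)) ?_
  -- exponential moment + Markov
  obtain ⟨lam, hlam⟩ : ∃ lam : ℝ, lam = 1 / (32 * τ * L) := ⟨_, rfl⟩
  have hlam0 : 0 ≤ lam := by
    rw [hlam]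
    exact (div_pos one_pos (mul_pos (mul_pos (by norm_num) hτpos) hLpos)).le
  have hdegH : ∀ x, x ∉ H → 2 * lam * ∑ y, |V x y| ≤ 1 := by
    intro x hx
    have hlt : ∑ y, |V x y| < τ := by
      by_contra hge
      exact hx ((hmemH x).2 (not_lt.1 hge))
    calc 2 * lam * ∑ y, |V x y| ≤ 2 * lam * τ := mul_le_mul_of_nonneg_left hlt.le (by positivity)
      _ = 1 / (16 * L) := by rw [hlam]; field_simp; ring
      _ ≤ 1 := by rw [div_le_one (by linarith)]; linarith
  have hmom := expMoment_le V hVsym hV0 hqpos H hlam0 hdegH (q := q)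
  simp only [← hT] at hmom
  have hmarkov := card_filter_le_mul_exp T hlam0 (W / 2)
  have hdeg2 : ∑ x ∈ Hᶜ, (∑ y, |V x y|) ^ 2 ≤ τ * (2 * L * W) := by
    calc ∑ x ∈ Hᶜ, (∑ y, |V x y|) ^ 2 ≤ ∑ x ∈ Hᶜ, τ * ∑ y, |V x y| := by
          refine Finset.sum_le_sum fun x hx => ?_
          have hx' : x ∉ H := Finset.mem_compl.1 hx
          have hlt : ∑ y, |V x y| < τ := by
            by_contra hge
            exact hx' ((hmemH x).2 (not_lt.1 hge))
          rw [sq]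
          exact mul_le_mul_of_nonneg_right hlt.le (hdeg0 x)
      _ = τ * ∑ x ∈ Hᶜ, ∑ y, |V x y| := by rw [Finset.mul_sum]
      _ ≤ τ * ∑ x, ∑ y, |V x y| := by
          refine mul_le_mul_of_nonneg_left ?_ hτpos.le
          exact Finset.sum_le_sum_of_subset_of_nonneg (Finset.subset_univ _) fun x _ _ => hdeg0 x
      _ ≤ τ * (2 * L * W) := mul_le_mul_of_nonneg_left hdegsum hτpos.le
  have h1 : Real.exp (4 * lam ^ 2 * ∑ x ∈ Hᶜ, (∑ y, |V x y|) ^ 2) ≤ Real.exp (4 * lam ^ 2 * (τ * (2 * L * W))) :=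
    Real.exp_le_exp.2 (mul_le_mul_of_nonneg_left hdeg2 (by positivity))
  have h2 : -(lam * (W / 2)) + 4 * lam ^ 2 * (τ * (2 * L * W)) = -(1 / (512 * L ^ 2 * Real.sqrt β)) := by
    rw [hlam, hτ]
    field_simp
    ring
  calc ((((Finset.univ : Finset (Fin m → Fin q)).filter (fun c => W / 2 ≤ T c)).card : ℝ))
      ≤ Real.exp (-(lam * (W / 2))) * ∑ c, Real.exp (lam * T c) := hmarkov
    _ ≤ Real.exp (-(lam * (W / 2))) * ((q : ℝ) ^ m * Real.exp (4 * lam ^ 2 * ∑ x ∈ Hᶜ, (∑ y, |V x y|) ^ 2)) :=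
        mul_le_mul_of_nonneg_left hmom (Real.exp_pos _).le
    _ ≤ Real.exp (-(lam * (W / 2))) * ((q : ℝ) ^ m * Real.exp (4 * lam ^ 2 * (τ * (2 * L * W)))) :=
        mul_le_mul_of_nonneg_left (mul_le_mul_of_nonneg_left h1 (by positivity)) (Real.exp_pos _).le
    _ = (q : ℝ) ^ m * Real.exp (-(lam * (W / 2)) + 4 * lam ^ 2 * (τ * (2 * L * W))) := by
        rw [Real.exp_add]; ring
    _ = (q : ℝ) ^ m * Real.exp (-(1 / (512 * L ^ 2 * Real.sqrt β))) := by rw [h2]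

/-! ## The catch bound -/

/-- **Catch probability of a clique-non-negative weighting.** For `4 ≤ k`, `k + 2 ≤ m` and a `k`-clique-non-negative
edge weighting `w` of `K_m`, the number of colourings `c : Fin m → Fin (k−1)` whose complete multipartite graph
carries negative `w`-weight is at most `(k−1)^m · exp(−1/(512·L²·√β))`, `L = 2k²−4k+1`, `β = C(k,2)(k−2)/(m−k)`. [new] -/
theorem card_badColourings_le {k : ℕ} (hk : 4 ≤ k) (hm : k + 2 ≤ m) (w : Edge m → ℝ)
    (hw : ∀ Q ∈ (Finset.univ : Finset (Fin m)).powersetCard k, 0 ≤ softWindow w Q) :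
    ((((Finset.univ : Finset (Fin m → Fin (k - 1))).filter fun c =>
        ∑ e, (if colorVec c e = true then w e else 0) < 0).card : ℝ)) ≤
      ((k - 1 : ℕ) : ℝ) ^ m * Real.exp (-(1 / (512 * (2 * (k : ℝ) ^ 2 - 4 * k + 1) ^ 2 *
        Real.sqrt (((k : ℝ) * (k - 1) / 2) * ((k - 2) / (m - k)))))) := by
  classical
  have hq3 : 3 ≤ k - 1 := by omega
  have hkR : (4 : ℝ) ≤ k := by exact_mod_cast hk
  have hmk : (0 : ℝ) < (m : ℝ) - k := by
    have : ((k : ℝ) + 2 ≤ m) := by exact_mod_cast hm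
    linarith
  have hL1 : (1 : ℝ) ≤ 2 * (k : ℝ) ^ 2 - 4 * k + 1 := by nlinarith
  have hBm0 : (0 : ℝ) < ((k : ℝ) - 2) / ((m : ℝ) - k) := div_pos (by linarith) hmk
  have hC2 : ((k.choose 2 : ℕ) : ℝ) = (k : ℝ) * (k - 1) / 2 := Nat.cast_choose_two ℝ k
  have hC2pos : (1 : ℝ) ≤ (k : ℝ) * (k - 1) / 2 := by nlinarith
  have hβ0 : (0 : ℝ) < ((k : ℝ) * (k - 1) / 2) * (((k : ℝ) - 2) / ((m : ℝ) - k)) := mul_pos (by linarith) hBm0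
  -- Step 1: minimal reduction
  obtain ⟨v, hv, hvw, htight⟩ := exists_minimal_le (by omega : 2 ≤ k) (by omega : k ≤ m) w hw
  have hsub : ((Finset.univ : Finset (Fin m → Fin (k - 1))).filter fun c =>
        ∑ e, (if colorVec c e = true then w e else 0) < 0) ⊆
      ((Finset.univ : Finset (Fin m → Fin (k - 1))).filter fun c =>
        ∑ e, (if colorVec c e = true then v e else 0) < 0) := by
    intro c hc
    rw [Finset.mem_filter] at hc ⊢
    exact ⟨hc.1, lt_of_le_of_lt (bichSum_mono hvw _) hc.2⟩
  refine le_trans (Nat.cast_le.2 (Finset.card_le_card hsub)) ?_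
  -- Step 2: ℓ₁-domination and the total `W`
  obtain ⟨W, hW⟩ : ∃ W : ℝ, W = ∑ e, v e := ⟨_, rfl⟩
  have hl1 := abs_sum_le_of_cliqueNonneg_at hk hm v hv
  rw [← hW] at hl1
  by_cases hWpos : W ≤ 0
  · -- then `v = 0` and no colouring is bad
    have habs0 : ∑ e, |v e| ≤ 0 := hl1.trans (by nlinarith)
    have hv0 : ∀ e, v e = 0 := by
      intro e
      have h := (Finset.sum_eq_zero_iff_of_nonneg (fun f _ => abs_nonneg (v f))).1
        (le_antisymm habs0 (Finset.sum_nonneg fun f _ => abs_nonneg (v f))) e (Finset.mem_univ e)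
      exact abs_eq_zero.1 h
    have hempty : ((Finset.univ : Finset (Fin m → Fin (k - 1))).filter fun c =>
        ∑ e, (if colorVec c e = true then v e else 0) < 0) = ∅ := by
      refine Finset.filter_false_of_mem fun c _ => ?_
      rw [not_lt]
      exact Finset.sum_nonneg fun e _ => by rw [hv0 e]; split_ifs <;> exact le_rfl
    rw [hempty, Finset.card_empty, Nat.cast_zero]
    positivity
  push Not at hWpos
  -- Step 3: entry bounds `|v e| ≤ βW`
  have hneg : ∀ e, -v e ≤ ((k : ℝ) - 2) / ((m : ℝ) - k) * W := by
    intro e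
    have h := neg_entry_le_of_cliqueNonneg_at hk hm v hv e
    rw [← hW] at h
    linarith
  have hBmW : 0 ≤ ((k : ℝ) - 2) / ((m : ℝ) - k) * W := (mul_pos hBm0 hWpos).le
  have habs : ∀ e, |v e| ≤ ((k : ℝ) * (k - 1) / 2) * (((k : ℝ) - 2) / ((m : ℝ) - k)) * W := by
    intro e
    rw [abs_le]
    constructor
    · have : (1 : ℝ) * (((k : ℝ) - 2) / ((m : ℝ) - k) * W) ≤
          ((k : ℝ) * (k - 1) / 2) * (((k : ℝ) - 2) / ((m : ℝ) - k) * W) :=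
        mul_le_mul_of_nonneg_right hC2pos hBmW
      linarith [hneg e]
    · by_cases hpos : 0 < v e
      · obtain ⟨Q, hQ, heQ, h0⟩ := htight e hpos
        rw [Finset.mem_powersetCard] at hQ
        have h := le_of_tight v hQ.2 h0 heQ hneg
        rw [hC2] at h
        nlinarith
      · push Not at hpos
        exact hpos.trans (by nlinarith)
  -- Step 4: the symmetric matrix of `v`
  obtain ⟨V, hVdef⟩ : ∃ V : Fin m → Fin m → ℝ,
      V = fun x y => if h : x = y then 0 else v ⟨s(x, y), CliqueExtLowerBound.Negative.mk_mem_edgeSet_top h⟩ := ⟨_, rfl⟩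
  have hV0 : ∀ x, V x x = 0 := fun x => by rw [hVdef]; simp
  have hVoff : ∀ (x y : Fin m) (h : x ≠ y), V x y = v ⟨s(x, y), CliqueExtLowerBound.Negative.mk_mem_edgeSet_top h⟩ := fun x y h => by
    rw [hVdef]; simp [h]
  have hVsym : ∀ x y, V x y = V y x := by
    intro x y
    by_cases h : x = y
    · rw [h]
    · rw [hVoff x y h, hVoff y x (Ne.symm h)]
      congr 1
      exact Subtype.ext Sym2.eq_swap
  have hVabs : ∀ x y, |V x y| ≤ ((k : ℝ) * (k - 1) / 2) * (((k : ℝ) - 2) / ((m : ℝ) - k)) * W := by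
    intro x y
    by_cases h : x = y
    · rw [h, hV0, abs_zero]; exact (mul_pos hβ0 hWpos).le
    · rw [hVoff x y h]; exact habs _
  -- Step 5: conversions
  have hmass : ∑ e, v e = (∑ x, ∑ y, V x y) / 2 := sum_edge_eq_half_sum_sum v V hV0 hVoff
  have habsmass : ∑ e, |v e| = (∑ x, ∑ y, |V x y|) / 2 :=
    sum_edge_eq_half_sum_sum (fun e => |v e|) (fun x y => |V x y|) (fun x => by rw [hV0, abs_zero])
      (fun x y h => by rw [hVoff x y h])
  have hmono : ∀ c : Fin m → Fin (k - 1), ∑ e, (if colorVec c e = false then v e else 0) =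
      (∑ x, ∑ y, if c x = c y then V x y else 0) / 2 := by
    intro c
    refine sum_edge_eq_half_sum_sum _ _ (fun x => by rw [if_pos rfl, hV0]) (fun x y h => ?_)
    by_cases hc : c x = c y
    · rw [if_pos hc, if_pos ((colorVec_mk_eq_false_iff c _).2 hc), hVoff x y h]
    · rw [if_neg hc, if_neg (fun h' => hc ((colorVec_mk_eq_false_iff c _).1 h'))]
  -- bad ⟹ monochromatic mass `> W`
  have hsub2 : ((Finset.univ : Finset (Fin m → Fin (k - 1))).filter fun c =>
        ∑ e, (if colorVec c e = true then v e else 0) < 0) ⊆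
      ((Finset.univ : Finset (Fin m → Fin (k - 1))).filter fun c =>
        W < (∑ a, ∑ b, if c a = c b then V a b else 0) / 2) := by
    intro c hc
    rw [Finset.mem_filter] at hc ⊢
    refine ⟨hc.1, ?_⟩
    rw [← hmono c]
    have hsplit : ∑ e, v e = ∑ e, (if colorVec c e = true then v e else 0) +
        ∑ e, (if colorVec c e = false then v e else 0) := by
      rw [← Finset.sum_add_distrib]
      refine Finset.sum_congr rfl fun e _ => ?_
      rcases Bool.eq_false_or_eq_true (colorVec c e) with h | h
      · rw [h]; simp
      · rw [h]; simp
    rw [hW, hsplit]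
    linarith [hc.2]
  refine le_trans (Nat.cast_le.2 (Finset.card_le_card hsub2)) ?_
  have hdegsum : ∑ x, ∑ y, |V x y| ≤ 2 * (2 * (k : ℝ) ^ 2 - 4 * k + 1) * W := by
    have : ∑ x, ∑ y, |V x y| = 2 * ∑ e, |v e| := by rw [habsmass]; ring
    rw [this]; nlinarith
  have hmass2 : ∑ x, ∑ y, V x y = 2 * W := by rw [hW, hmass]; ring
  exact card_monoMass_gt_le hq3 V hVsym hV0 hWpos hL1 hβ0 hdegsum hVabs hmass2

/-- **Catch probability** (registered form of `card_badColourings_le`). [new] -/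
theorem negCover_catch : ∀ {m k : ℕ}, 4 ≤ k → k + 2 ≤ m → ∀ (w : Edge m → ℝ), (∀ Q ∈ (Finset.univ : Finset (Fin m)).powersetCard k, 0 ≤ softWindow w Q) → ((((Finset.univ : Finset (Fin m → Fin (k - 1))).filter fun c => ∑ e, (if colorVec c e = true then w e else 0) < 0).card : ℝ)) ≤ ((k - 1 : ℕ) : ℝ) ^ m * Real.exp (-(1 / (512 * (2 * (k : ℝ) ^ 2 - 4 * k + 1) ^ 2 * Real.sqrt (((k : ℝ) * (k - 1) / 2) * ((k - 2) / (m - k)))))) :=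
  fun hk hm w hw => card_badColourings_le hk hm w hw

end

end Summit.PneNP.PneNP.Theorems
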